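/-
Copyright (c) 2026 the pub-hodgecm-mathlib formalisation cell (harness21).  Prover seat hodgecm-mathlib-LH4-p12 (g7), req620 Track A «(D-RAM) FOUR-FRAME», line LH4
(STAGE-1b tier-0 regular row, (L-sq) producer (S2b-T) «THE LABELLED TRUNK», rotation part: the κ-WEIGHTED, LABEL-CUT stratum sums move with their slot AND their label under a
coordinate permutation — the common twin of ★ (LH4-p09 (g3) lineage) `F0P3cDyRamDiagonalKappaPermutation` (κ, unlabelled) and ★ LH4-p09 (g8)
`F0P3cDyRamLabelledStrataPermutation` (labelled, unweighted)).  2026-09-04.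
-/
import Summits.HodgeConjecture.HodgeConjecture.Theorems.F0P3cDyRamDiagonalKappaPermutation     -- ★ (LH4-p09 (g3)): `kappaCount_mul_stabiliserWeight_mapGL_perm`, `exists_gl_rescale_swap02`, the unlabelled adapters
import Summits.HodgeConjecture.HodgeConjecture.Theorems.F0P3cDyRamLabelledStrataPermutation   -- ★ (LH4-p09 (g8)): `image_mapGL_stratum_sep_latticeInLevel` (the label rides along)
import HarnessLib

/-!
# Crux `H413`, line LH4 «(D-RAM) FOUR-FRAME» — (S2b-T), rotation part: LABEL-CUT κ-WEIGHTED STRATUM SUMS UNDER COORDINATE PERMUTATIONS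

The labelled trunk of the (L-sq) law needs the labelled type-0 κ-sockets on the ROTATED glued families G2 `(2ρ+s, 2ρ, 2ρ+s)` and G3 `(2ρ+s, 2ρ+s, 2ρ)`.  Unlabelled, ★
`F0P3cDyRamDiagonalKappaGluedRotations` obtains them from the G1 socket through the κ-permutation adapters of ★ `F0P3cDyRamDiagonalKappaPermutation` (the swap `(0 1)`:
datum `(β, α; n₂, n₁, n₃)`; the swap `(0 2)` + unit rescaling: datum `(α⁻¹, βα⁻¹; n₃, n₂, n₁)`; slots permuted, `κ_i(P·M)·w(P·M) = κ_{π i}(M)·w(M)`).  With a level label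
`diag(e)·M ⊆ ϖ^ℓ·M` riding along, the label vector is permuted too: `e ↦ (e₁, e₀, e₂)` resp. `e ↦ (e₂, e₁, e₀)` (★ LH4-p09 `image_mapGL_stratum_sep_latticeInLevel`) — so a G1
statement must be known for a GENERIC label vector to feed the rotations (the (L-sq) label of record `((α−1)², (β−1)², 0)` is NOT stable under the `(0 2)`-rescaling).

* §1 `finsum_kappaCount_mul_stabiliserWeight_stratum_sep_latticeInLevel_perm` — the label-cut κ-weighted stratum sum moves with its slot and its label (any type `tv`).
* §2 `…_sep_latticeInLevel_swap01_of` ∕ `…_swap02_of` — the two labelled κ-adapters: from ANY labelled statement on `stratum(T′, (a,b,c))` (hypothesis `Hyp`, value `F`, both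
  functions of the element datum AND the label vector) to `stratum(T, (b,a,c))` resp. `stratum(T, (c,b,a))`.
* §3 `…_stratum_G2_sep_latticeInLevel_of_G1` ∕ `…_G3_…_of_G1` — the type-0 glued rotations: labelled κ-G2 ∕ κ-G3 from any labelled κ-G1 statement.

HONEST LABEL: helper lane (`--supports stmt-HodgeConjecture-24833`), count-neutral; transport identities only (no census is evaluated here); pays no tier-0 row by itself
(T₊∕T₋∕reg OPEN; the labelled trunk stays OPEN); HC_CM is proved only modulo the 7 printed citations (2 remaining named inputs: hLiu418 = stmt-HodgeConjecture-24832, h413 =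
stmt-HodgeConjecture-24833) until rung 0 closes.

## References (NEVER `[KR2]`)
* [Kottwitz1986BaseChangeUnits] R. E. Kottwitz, *Base change for unit elements of Hecke algebras*, Compositio Math. 60 (1986), §1 pp. 240–241.
* [Rogawski1990] J. D. Rogawski, *Automorphic Representations of Unitary Groups in Three Variables*, Ann. of Math. Stud. 123 (1990), §4.9 Prop. 4.9.1 (a) p. 55.
* [LanglandsShelstad1987] R. P. Langlands, D. Shelstad, *On the definition of transfer factors*, Math. Ann. 278 (1987), §3.
-/

set_option autoImplicit false

noncomputable section

namespace Summit.HodgeConjecture.HodgeConjecture.Cruxes.H413.F0P3cDyRamLabelledKappaStrataPermutation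

open Matrix
open Literature.NumberTheory.Automorphic Literature.NumberTheory.Automorphic.HermitianLattice
open Literature.NumberTheory.Automorphic.UnitaryLatticeTree Literature.NumberTheory.Automorphic.UnitaryThreeFourFrame
open Summit.HodgeConjecture.HodgeConjecture.Cruxes.H413.F0P3cDyRamDiagonalTorusDefs
open Summit.HodgeConjecture.HodgeConjecture.Cruxes.H413.F0P3cDyRamDiagonalStrataDefs
open Summit.HodgeConjecture.HodgeConjecture.Cruxes.H413.F0P3cDyRamDiagonalPermutation
open Summit.HodgeConjecture.HodgeConjecture.Cruxes.H413.F0P3cDyRamDiagonalKappaCountDefs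
open Summit.HodgeConjecture.HodgeConjecture.Cruxes.H413.F0P3cDyRamDiagonalKappaPermutation
open Summit.HodgeConjecture.HodgeConjecture.Cruxes.H413.F0P3cDyRamFourFrameCensusDefs
open Summit.HodgeConjecture.HodgeConjecture.Cruxes.H413.F0P3cDyRamLabelledStrataPermutation
open scoped Valued WithZero Matrix MatrixGroups

/-! ## §1  The label-cut κ-weighted stratum sum under a coordinate permutation -/

section Transport

variable {K : Type} [Field K] [Valued K ℤᵐ⁰]

/-- **THE LABEL-CUT κ-WEIGHTED COUNT OF A STRATUM MOVES WITH ITS SLOT AND ITS LABEL**: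
`Σᶠ_{M ∈ stratum(T,a), diag(e)M ⊆ ϖ^ℓM} κ_i(M)·w(M) = Σᶠ_{M ∈ stratum(P⁻¹TP, a∘π⁻¹), diag(e∘π⁻¹)M ⊆ ϖ^ℓM} κ_{π i}(M)·w(M)` (any `tv`) — ★ LH4-p09
`image_mapGL_stratum_sep_latticeInLevel` + ★ `kappaCount_mul_stabiliserWeight_mapGL_perm`. [cite: Kottwitz1986BaseChangeUnits, §1 pp. 240–241]
[cite: Rogawski1990, §4.9 Prop. 4.9.1 (a) p. 55] [cite: LanglandsShelstad1987, §3] -/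
theorem finsum_kappaCount_mul_stabiliserWeight_stratum_sep_latticeInLevel_perm (σ : K →+* K) (ϖ : K) {π : Equiv.Perm (Fin 3)} (P : GL (Fin 3) K)
    (hP : (P : Matrix (Fin 3) (Fin 3) K) = π.permMatrix K) (T : GL (Fin 3) K) (a : Fin 3 → ℕ) (tv : ℕ) (i : Fin 3) (ℓ : ℕ) (e : Fin 3 → K) :
    ∑ᶠ M ∈ {M | M ∈ stratum σ ϖ T a ∧ LatticeInLevel ϖ ℓ (Matrix.diagonal e) M}, (kappaCount σ ϖ tv i M : ℚ) * stabiliserWeight σ M =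
      ∑ᶠ M ∈ {M | M ∈ stratum σ ϖ (P⁻¹ * T * P) (a ∘ ⇑π.symm) ∧ LatticeInLevel ϖ ℓ (Matrix.diagonal (e ∘ ⇑π.symm)) M},
        (kappaCount σ ϖ tv (π i) M : ℚ) * stabiliserWeight σ M := by
  rw [← image_mapGL_stratum_sep_latticeInLevel σ ϖ P hP T a ℓ e, finsum_mem_image (mapGL_injective P).injOn]
  exact finsum_mem_congr rfl fun M _ => kappaCount_mul_stabiliserWeight_mapGL_perm σ ϖ P hP tv i M

end Transport

/-! ## §2  The two labelled κ-adapters over an element datum -/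

section Adapters

variable {K : Type} [Field K] [Valued K ℤᵐ⁰] {σ : K →+* K} {ϖ : K} {α β : K} {N₀ n₁ n₂ n₃ : ℕ} {T : GL (Fin 3) K}

omit [Field K] [Valued K ℤᵐ⁰] in
/-- The label vector under the swap `(0 1)`. -/
theorem comp_swap01_symm_eq (e : Fin 3 → K) : e ∘ ⇑(Equiv.swap (0 : Fin 3) 1).symm = ![e 1, e 0, e 2] := by
  ext i; fin_cases i <;> rfl

omit [Field K] [Valued K ℤᵐ⁰] in
/-- The label vector under the swap `(0 2)`. -/
theorem comp_swap02_symm_eq (e : Fin 3 → K) : e ∘ ⇑(Equiv.swap (0 : Fin 3) 2).symm = ![e 2, e 1, e 0] := by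
  ext i; fin_cases i <;> rfl

/-- **LABELLED κ-ADAPTER `(a,b,c) ↦ (b,a,c)`** (any `tv`): if at every element datum `(α′, β′; n′)`, `T′ = diag(α′, β′, 1)`, and every label vector `e′` with `Hyp α′ β′ n′ e′` the
slot-`i` label-cut κ-count of `stratum(T′, (a,b,c))` at `(ℓ, e′)` is `F α′ β′ n′ e′ i`, then at a datum whose SWAPPED letters satisfy `Hyp β α n₂ n₁ n₃ (e₁, e₀, e₂)` the slot-`i`
label-cut κ-count of `stratum(T, (b,a,c))` at `(ℓ, e)` is `F β α n₂ n₁ n₃ (e₁, e₀, e₂) (swap 0 1 i)` — §1 at the swap `(0 1)`, ★ `isElementDatum_swap`, ★ `coe_conj_eq_diagonal` (labelled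
twin of ★ `finsum_kappaCount_mul_stabiliserWeight_stratum_swap01_of`). [cite: Kottwitz1986BaseChangeUnits, §1 pp. 240–241] [cite: Rogawski1990, §4.9 Prop. 4.9.1 (a) p. 55] -/
theorem finsum_kappaCount_mul_stabiliserWeight_stratum_sep_latticeInLevel_swap01_of (hE : IsElementDatum σ ϖ N₀ α β n₁ n₂ n₃)
    (hT : (T : Matrix (Fin 3) (Fin 3) K) = Matrix.diagonal ![α, β, 1]) (tv a b c ℓ : ℕ)
    (Hyp : K → K → ℕ → ℕ → ℕ → (Fin 3 → K) → Prop) (F : K → K → ℕ → ℕ → ℕ → (Fin 3 → K) → Fin 3 → ℚ)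
    (hG1 : ∀ {α' β' : K} {n₁' n₂' n₃' : ℕ} (T' : GL (Fin 3) K) (e' : Fin 3 → K), IsElementDatum σ ϖ N₀ α' β' n₁' n₂' n₃' →
      (T' : Matrix (Fin 3) (Fin 3) K) = Matrix.diagonal ![α', β', 1] → Hyp α' β' n₁' n₂' n₃' e' →
        ∀ i : Fin 3, ∑ᶠ M ∈ {M | M ∈ stratum σ ϖ T' ![a, b, c] ∧ LatticeInLevel ϖ ℓ (Matrix.diagonal e') M},
          (kappaCount σ ϖ tv i M : ℚ) * stabiliserWeight σ M = F α' β' n₁' n₂' n₃' e' i)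
    (e : Fin 3 → K) (hHyp : Hyp β α n₂ n₁ n₃ ![e 1, e 0, e 2]) (i : Fin 3) :
    ∑ᶠ M ∈ {M | M ∈ stratum σ ϖ T ![b, a, c] ∧ LatticeInLevel ϖ ℓ (Matrix.diagonal e) M}, (kappaCount σ ϖ tv i M : ℚ) * stabiliserWeight σ M =
      F β α n₂ n₁ n₃ ![e 1, e 0, e 2] (Equiv.swap (0 : Fin 3) 1 i) := by
  obtain ⟨P, hP⟩ := exists_gl_coe_eq_permMatrix (K := K) (Equiv.swap (0 : Fin 3) 1)
  rw [finsum_kappaCount_mul_stabiliserWeight_stratum_sep_latticeInLevel_perm σ ϖ P hP T _ tv i ℓ e]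
  have ha : (![b, a, c] : Fin 3 → ℕ) ∘ ⇑(Equiv.swap (0 : Fin 3) 1).symm = ![a, b, c] := by
    ext i; fin_cases i <;> rfl
  have hd : (![α, β, 1] : Fin 3 → K) ∘ ⇑(Equiv.swap (0 : Fin 3) 1).symm = ![β, α, 1] := by
    ext i; fin_cases i <;> rfl
  rw [ha, comp_swap01_symm_eq]
  exact hG1 _ _ (isElementDatum_swap hE) (by rw [coe_conj_eq_diagonal P hP T hT, hd]) hHyp _

/-- **LABELLED κ-ADAPTER `(a,b,c) ↦ (c,b,a)`** (any `tv`): the swap `(0 2)` followed by the unit rescaling `α⁻¹` — datum `(α⁻¹, βα⁻¹; n₃, n₂, n₁)` (★ `isElementDatum_rescale`,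
★ `exists_gl_rescale_swap02`, ★ `stratum_eq_of_coe_eq_smul`), label vector `(e₂, e₁, e₀)`; value `F α⁻¹ (βα⁻¹) n₃ n₂ n₁ (e₂, e₁, e₀) (swap 0 2 i)` under
`Hyp α⁻¹ (βα⁻¹) n₃ n₂ n₁ (e₂, e₁, e₀)` (labelled twin of ★ `finsum_kappaCount_mul_stabiliserWeight_stratum_swap02_of`). [cite: Kottwitz1986BaseChangeUnits, §1 pp. 240–241]
[cite: Rogawski1990, §4.9 Prop. 4.9.1 (a) p. 55] -/
theorem finsum_kappaCount_mul_stabiliserWeight_stratum_sep_latticeInLevel_swap02_of (hvσ : ∀ x, Valued.v (σ x) = Valued.v x)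
    (hE : IsElementDatum σ ϖ N₀ α β n₁ n₂ n₃) (hT : (T : Matrix (Fin 3) (Fin 3) K) = Matrix.diagonal ![α, β, 1]) (tv a b c ℓ : ℕ)
    (Hyp : K → K → ℕ → ℕ → ℕ → (Fin 3 → K) → Prop) (F : K → K → ℕ → ℕ → ℕ → (Fin 3 → K) → Fin 3 → ℚ)
    (hG1 : ∀ {α' β' : K} {n₁' n₂' n₃' : ℕ} (T' : GL (Fin 3) K) (e' : Fin 3 → K), IsElementDatum σ ϖ N₀ α' β' n₁' n₂' n₃' →
      (T' : Matrix (Fin 3) (Fin 3) K) = Matrix.diagonal ![α', β', 1] → Hyp α' β' n₁' n₂' n₃' e' →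
        ∀ i : Fin 3, ∑ᶠ M ∈ {M | M ∈ stratum σ ϖ T' ![a, b, c] ∧ LatticeInLevel ϖ ℓ (Matrix.diagonal e') M},
          (kappaCount σ ϖ tv i M : ℚ) * stabiliserWeight σ M = F α' β' n₁' n₂' n₃' e' i)
    (e : Fin 3 → K) (hHyp : Hyp α⁻¹ (β * α⁻¹) n₃ n₂ n₁ ![e 2, e 1, e 0]) (i : Fin 3) :
    ∑ᶠ M ∈ {M | M ∈ stratum σ ϖ T ![c, b, a] ∧ LatticeInLevel ϖ ℓ (Matrix.diagonal e) M}, (kappaCount σ ϖ tv i M : ℚ) * stabiliserWeight σ M =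
      F α⁻¹ (β * α⁻¹) n₃ n₂ n₁ ![e 2, e 1, e 0] (Equiv.swap (0 : Fin 3) 2 i) := by
  have hα : α * σ α = 1 := hE.1
  have hvα : Valued.v α = 1 := by
    have h : Valued.v α * Valued.v α = 1 := by nth_rw 2 [← hvσ α]; rw [← map_mul, hα, map_one]
    rw [← pow_two] at h
    exact ((pow_eq_one_iff).1 h).resolve_right two_ne_zero
  obtain ⟨P, hP⟩ := exists_gl_coe_eq_permMatrix (K := K) (Equiv.swap (0 : Fin 3) 2)
  rw [finsum_kappaCount_mul_stabiliserWeight_stratum_sep_latticeInLevel_perm σ ϖ P hP T _ tv i ℓ e]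
  have ha : (![c, b, a] : Fin 3 → ℕ) ∘ ⇑(Equiv.swap (0 : Fin 3) 2).symm = ![a, b, c] := by
    ext i; fin_cases i <;> rfl
  rw [ha, comp_swap02_symm_eq]
  obtain ⟨T'', hT'', hTT⟩ := exists_gl_rescale_swap02 hE hT P hP
  rw [← stratum_eq_of_coe_eq_smul σ ϖ (by rw [map_inv₀, hvα, inv_one]) hTT]
  exact hG1 _ _ (isElementDatum_rescale hvσ hE) hT'' hHyp _

end Adapters

/-! ## §3  The type-0 glued rotations: labelled κ-G2 ∕ κ-G3 from any labelled κ-G1 statement -/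

section Rotations

variable {K : Type} [Field K] [Valued K ℤᵐ⁰] {σ : K →+* K} {ϖ : K} {α β : K} {N₀ n₁ n₂ n₃ : ℕ} {T : GL (Fin 3) K}

/-- **LABELLED κ-G2 `(2ρ+s, 2ρ, 2ρ+s)` FROM ANY LABELLED κ-G1 STATEMENT** (type 0; the swap `(0 1)`: datum `(β, α; n₂, n₁, n₃)`, label `(e₁, e₀, e₂)`, slot `swap 0 1 i`).
[cite: Kottwitz1986BaseChangeUnits, §1 pp. 240–241] [cite: Rogawski1990, §4.9 Prop. 4.9.1 (a) p. 55] [cite: LanglandsShelstad1987, §3] -/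
theorem finsum_kappaCount_mul_stabiliserWeight_stratum_G2_sep_latticeInLevel_of_G1 (hE : IsElementDatum σ ϖ N₀ α β n₁ n₂ n₃)
    (hT : (T : Matrix (Fin 3) (Fin 3) K) = Matrix.diagonal ![α, β, 1]) (ρ s ℓ : ℕ)
    (Hyp : K → K → ℕ → ℕ → ℕ → (Fin 3 → K) → Prop) (F : K → K → ℕ → ℕ → ℕ → (Fin 3 → K) → Fin 3 → ℚ)
    (hG1 : ∀ {α' β' : K} {n₁' n₂' n₃' : ℕ} (T' : GL (Fin 3) K) (e' : Fin 3 → K), IsElementDatum σ ϖ N₀ α' β' n₁' n₂' n₃' →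
      (T' : Matrix (Fin 3) (Fin 3) K) = Matrix.diagonal ![α', β', 1] → Hyp α' β' n₁' n₂' n₃' e' →
        ∀ i : Fin 3, ∑ᶠ M ∈ {M | M ∈ stratum σ ϖ T' ![2 * ρ, 2 * ρ + s, 2 * ρ + s] ∧ LatticeInLevel ϖ ℓ (Matrix.diagonal e') M},
          (kappaCount σ ϖ 0 i M : ℚ) * stabiliserWeight σ M = F α' β' n₁' n₂' n₃' e' i)
    (e : Fin 3 → K) (hHyp : Hyp β α n₂ n₁ n₃ ![e 1, e 0, e 2]) (i : Fin 3) :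
    ∑ᶠ M ∈ {M | M ∈ stratum σ ϖ T ![2 * ρ + s, 2 * ρ, 2 * ρ + s] ∧ LatticeInLevel ϖ ℓ (Matrix.diagonal e) M},
        (kappaCount σ ϖ 0 i M : ℚ) * stabiliserWeight σ M =
      F β α n₂ n₁ n₃ ![e 1, e 0, e 2] (Equiv.swap (0 : Fin 3) 1 i) :=
  finsum_kappaCount_mul_stabiliserWeight_stratum_sep_latticeInLevel_swap01_of hE hT 0 (2 * ρ) (2 * ρ + s) (2 * ρ + s) ℓ Hyp F hG1 e hHyp i

/-- **LABELLED κ-G3 `(2ρ+s, 2ρ+s, 2ρ)` FROM ANY LABELLED κ-G1 STATEMENT** (type 0; the swap `(0 2)` + rescaling: datum `(α⁻¹, βα⁻¹; n₃, n₂, n₁)`, label `(e₂, e₁, e₀)`, slot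
`swap 0 2 i`). [cite: Kottwitz1986BaseChangeUnits, §1 pp. 240–241] [cite: Rogawski1990, §4.9 Prop. 4.9.1 (a) p. 55] [cite: LanglandsShelstad1987, §3] -/
theorem finsum_kappaCount_mul_stabiliserWeight_stratum_G3_sep_latticeInLevel_of_G1 (hvσ : ∀ x, Valued.v (σ x) = Valued.v x)
    (hE : IsElementDatum σ ϖ N₀ α β n₁ n₂ n₃) (hT : (T : Matrix (Fin 3) (Fin 3) K) = Matrix.diagonal ![α, β, 1]) (ρ s ℓ : ℕ)
    (Hyp : K → K → ℕ → ℕ → ℕ → (Fin 3 → K) → Prop) (F : K → K → ℕ → ℕ → ℕ → (Fin 3 → K) → Fin 3 → ℚ)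
    (hG1 : ∀ {α' β' : K} {n₁' n₂' n₃' : ℕ} (T' : GL (Fin 3) K) (e' : Fin 3 → K), IsElementDatum σ ϖ N₀ α' β' n₁' n₂' n₃' →
      (T' : Matrix (Fin 3) (Fin 3) K) = Matrix.diagonal ![α', β', 1] → Hyp α' β' n₁' n₂' n₃' e' →
        ∀ i : Fin 3, ∑ᶠ M ∈ {M | M ∈ stratum σ ϖ T' ![2 * ρ, 2 * ρ + s, 2 * ρ + s] ∧ LatticeInLevel ϖ ℓ (Matrix.diagonal e') M},
          (kappaCount σ ϖ 0 i M : ℚ) * stabiliserWeight σ M = F α' β' n₁' n₂' n₃' e' i)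
    (e : Fin 3 → K) (hHyp : Hyp α⁻¹ (β * α⁻¹) n₃ n₂ n₁ ![e 2, e 1, e 0]) (i : Fin 3) :
    ∑ᶠ M ∈ {M | M ∈ stratum σ ϖ T ![2 * ρ + s, 2 * ρ + s, 2 * ρ] ∧ LatticeInLevel ϖ ℓ (Matrix.diagonal e) M},
        (kappaCount σ ϖ 0 i M : ℚ) * stabiliserWeight σ M =
      F α⁻¹ (β * α⁻¹) n₃ n₂ n₁ ![e 2, e 1, e 0] (Equiv.swap (0 : Fin 3) 2 i) :=
  finsum_kappaCount_mul_stabiliserWeight_stratum_sep_latticeInLevel_swap02_of hvσ hE hT 0 (2 * ρ) (2 * ρ + s) (2 * ρ + s) ℓ Hyp F hG1 e hHyp i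

end Rotations

end Summit.HodgeConjecture.HodgeConjecture.Cruxes.H413.F0P3cDyRamLabelledKappaStrataPermutation

end
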